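import Summits.Ventures.LatticeQCDFlow.Exactness.IMHModeHolding
import Summits.Ventures.LatticeQCDFlow.Scoring.DoeblinAutocorrelation
import Literature.Probability.MarkovChains.DoeblinMinorization
import HarnessLib

/-!
# The uniform ergodicity rate of flow-MCMC is exactly `1 − 1/w(x₀)` at an atom-free mode `x₀` of the weight

HONEST FRAMING: exact (Metropolis-corrected) sampling algorithms for lattice gauge theory;
figures of merit are autocorrelation/cost numbers at stated couplings and volumes; no
continuum-physics claim.

Venture `LatticeQCDFlow` (cell pub-lqcd), topic `Exactness`; FANOUT row 30 (lean-1, GEN-28).  NEW WORK of the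
cell, general state space.  For the independence Metropolis–Hastings kernel `K = indepMH q w` with the weight
normalised so that `π = w·q` is a probability law, and a bound `w ≤ W`, `IMHKernel.indepMH_apply_ge` is the
Doeblin minorisation `K(x, ·) ≥ W⁻¹ π` and the tree's `Doeblin.doeblin_iterate_sub_invariant_le` turns it into
the uniform rate `|μK^t(A) − π(A)| ≤ (1 − W⁻¹)^t` (Mengersen–Tweedie's direction, as in
`Phi4FlowSamplerErgodic.flowMCMC_uniformly_ergodic`).  Here, with `Exactness/IMHModeHolding`:

* **`indepMH_uniform_rate_of_mode`** — if the bound is ATTAINED, `W = w(x₀)` at a mode `x₀`, the rate is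
  `(1 − 1/w(x₀))^t = (1 − A(x₀))^t`, `A(x₀)` the acceptance mass at the mode (`= 1/w(x₀)` exactly);
* **`indepMH_dirac_mode_singleton_sub_eq`** — and it is SHARP: if the proposal has no atom at `x₀`, then from
  the Dirac start at `x₀` the deviation on the singleton `{x₀}` is `(δ_{x₀}K^t)({x₀}) − π({x₀}) = (1 − 1/w(x₀))^t`
  EXACTLY (`π({x₀}) = 0`, exact geometric holding law);
* **`indepMH_uniform_rate_sharp`** — together: THE UNIFORM TOTAL-VARIATION RATE OF FLOW-MCMC IS EXACTLY
  `1 − 1/w(x₀) = 1 − A(x₀)`: `sup_{μ, A} |μK^t(A) − π(A)| = (1 − A(x₀))^t` for every `t`, the supremum attained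
  at `μ = δ_{x₀}`, `A = {x₀}`;
* **`indepMH_autocorrelation_of_mode`** — the same number bounds stationary autocorrelations (the tree's
  Doeblin → Green–Kubo machinery, `Scoring/DoeblinAutocorrelation`): every bounded measurable `π`-centred `f`
  has `|C_f(t)| ≤ (1 − 1/w(x₀))^t ∫ f² dπ` and `τ_int(f) ≤ w(x₀) − 1/2 = 1/A(x₀) − 1/2` — never worse than the
  oscillation constant `sup w/inf w` of `Scoring/FlowSamplerAutocorrelation`, since `inf w ≤ 1`;
* **`hasSum_iterate_dirac_mode_singleton`** — the expected occupation time of the atom-free mode is exactly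
  `Σ_t (K^t δ_{x₀})({x₀}) = w(x₀) = 1/A(x₀)`.

Reading for the gauge samplers (`Scaling/AutoregressiveGaugeHeatBathColdExact`,
`…AllClosingColdExact`): their cold configuration is an atom-free mode, so their uniform convergence rates
are EXACTLY their cold escape probabilities `Z/(c^{#B} M^k)` and `Z/∏_ℓ c_{#C_ℓ}`
(`Scaling/AutoregressiveGaugeUniformRateExact`).  NOT CLAIMED: `L²(π)` spectral statements (the `L²` gap of
an independence sampler is also `1/w*`, Smith–Tierney ∕ Liu, not formalised here).

No `sorry`, nothing cited as a fact; general measurable space with measurable singletons.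
-/

noncomputable section

namespace Summit.Ventures.LatticeQCDFlow.Exactness

open MeasureTheory ProbabilityTheory Function
open scoped ENNReal

variable {Ω : Type*} [MeasurableSpace Ω] [MeasurableSingletonClass Ω]
variable {q : Measure Ω} [IsProbabilityMeasure q] {w : Ω → ℝ}

omit [MeasurableSingletonClass Ω] in
/-- For a normalised weight (`π = w·q` a probability law) a mode has `w(x₀) ≥ 1` (`1 = ∫ w dq ≤ w(x₀)`). [ours] -/
theorem one_le_of_mode {x₀ : Ω} (hmax : ∀ y, w y ≤ w x₀)
    [IsProbabilityMeasure (q.withDensity fun y => ENNReal.ofReal (w y))] : 1 ≤ w x₀ := by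
  have h1 : (q.withDensity fun y => ENNReal.ofReal (w y)) Set.univ = 1 := measure_univ
  rw [withDensity_apply _ MeasurableSet.univ, Measure.restrict_univ] at h1
  have h2 : ∫⁻ y, ENNReal.ofReal (w y) ∂q ≤ ∫⁻ _, ENNReal.ofReal (w x₀) ∂q :=
    lintegral_mono fun y => ENNReal.ofReal_le_ofReal (hmax y)
  rw [h1, lintegral_const, measure_univ, mul_one, ENNReal.one_le_ofReal] at h2
  exact h2

omit [MeasurableSingletonClass Ω] in
/-- **Uniform rate from the minorisation at a mode.**  `w` measurable, positive, normalised (`π = w·q` a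
probability law), `w ≤ w(x₀)`.  Then `|μK^t(A) − π(A)| ≤ (1 − 1/w(x₀))^t` for every initial law `μ`, set `A`,
time `t`. [ours] -/
theorem indepMH_uniform_rate_of_mode (hw : Measurable w) (hw0 : ∀ y, 0 < w y) {x₀ : Ω}
    (hmax : ∀ y, w y ≤ w x₀) [IsProbabilityMeasure (q.withDensity fun y => ENNReal.ofReal (w y))]
    (μ : Measure Ω) [IsProbabilityMeasure μ] (t : ℕ) (A : Set Ω) :
    |((fun m : Measure Ω => m.bind (indepMH q w))^[t] μ).real A -
        (q.withDensity fun y => ENNReal.ofReal (w y)).real A| ≤ (1 - (w x₀)⁻¹) ^ t := by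
  haveI : Fact (Measurable w) := ⟨hw⟩
  have hW : 1 ≤ w x₀ := one_le_of_mode (q := q) hmax
  have hε1 : (ENNReal.ofReal (w x₀))⁻¹ ≤ 1 := ENNReal.inv_le_one.2 (ENNReal.one_le_ofReal.2 hW)
  have h := Literature.Probability.MarkovChains.Doeblin.doeblin_iterate_sub_invariant_le
    (κ := indepMH q w) (ν := q.withDensity fun y => ENNReal.ofReal (w y)) (ε := (ENNReal.ofReal (w x₀))⁻¹)
    (fun x B hB => indepMH_apply_ge hw hw0 hmax x hB) hε1 (indepMH_invariant hw hw0) μ t A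
  rwa [ENNReal.toReal_inv, ENNReal.toReal_ofReal (zero_le_one.trans hW)] at h

omit [MeasurableSingletonClass Ω] [IsProbabilityMeasure q] in
/-- The target puts no mass on an atom-free point of the proposal. [ours] -/
theorem withDensity_singleton_eq_zero {x₀ : Ω} (hqx : q {x₀} = 0) :
    (q.withDensity fun y => ENNReal.ofReal (w y)) {x₀} = 0 :=
  withDensity_absolutelyContinuous _ _ hqx

/-- **Sharpness at the mode.**  If moreover `q{x₀} = 0`, then from the Dirac start at `x₀` the deviation on
`{x₀}` is exactly `(1 − 1/w(x₀))^t`. [ours] -/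
theorem indepMH_dirac_mode_singleton_sub_eq (hw : Measurable w) (hw0 : ∀ y, 0 < w y) {x₀ : Ω}
    (hmax : ∀ y, w y ≤ w x₀) (hqx : q {x₀} = 0)
    [IsProbabilityMeasure (q.withDensity fun y => ENNReal.ofReal (w y))] (t : ℕ) :
    ((fun m : Measure Ω => m.bind (indepMH q w))^[t] (Measure.dirac x₀)).real {x₀} -
        (q.withDensity fun y => ENNReal.ofReal (w y)).real {x₀} = (1 - (w x₀)⁻¹) ^ t := by
  have hone : ∫⁻ y, ENNReal.ofReal (w y) ∂q = ENNReal.ofReal 1 := by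
    have h1 : (q.withDensity fun y => ENNReal.ofReal (w y)) Set.univ = 1 := measure_univ
    rw [withDensity_apply _ MeasurableSet.univ, Measure.restrict_univ] at h1
    rw [h1, ENNReal.ofReal_one]
  rw [Measure.real, Measure.real, withDensity_singleton_eq_zero hqx, ENNReal.toReal_zero, sub_zero]
  have h := iterate_bind_indepMH_dirac_singleton_real_eq_of_mode (q := q) hw hw0 hqx hmax zero_le_one hone t
  rw [Measure.real] at h
  rw [h, one_div]

/-- **THE UNIFORM RATE IS EXACTLY `1 − 1/w(x₀)`.**  `w` measurable, positive, normalised, maximal at the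
atom-free point `x₀`.  For every `t`: every initial law and every set deviate from `π` by at most
`(1 − 1/w(x₀))^t`, and the Dirac start at `x₀` deviates on `{x₀}` by exactly that much. [ours] -/
theorem indepMH_uniform_rate_sharp (hw : Measurable w) (hw0 : ∀ y, 0 < w y) {x₀ : Ω}
    (hmax : ∀ y, w y ≤ w x₀) (hqx : q {x₀} = 0)
    [IsProbabilityMeasure (q.withDensity fun y => ENNReal.ofReal (w y))] (t : ℕ) :
    (∀ (μ : Measure Ω) [IsProbabilityMeasure μ] (A : Set Ω),
      |((fun m : Measure Ω => m.bind (indepMH q w))^[t] μ).real A -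
        (q.withDensity fun y => ENNReal.ofReal (w y)).real A| ≤ (1 - (w x₀)⁻¹) ^ t) ∧
    |((fun m : Measure Ω => m.bind (indepMH q w))^[t] (Measure.dirac x₀)).real {x₀} -
        (q.withDensity fun y => ENNReal.ofReal (w y)).real {x₀}| = (1 - (w x₀)⁻¹) ^ t := by
  refine ⟨fun μ _ A => indepMH_uniform_rate_of_mode hw hw0 hmax μ t A, ?_⟩
  rw [indepMH_dirac_mode_singleton_sub_eq hw hw0 hmax hqx t, abs_of_nonneg]
  exact pow_nonneg (sub_nonneg.2 (inv_le_one_of_one_le₀ (one_le_of_mode (q := q) hmax))) t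

omit [MeasurableSingletonClass Ω] in
/-- **The autocorrelation ceiling with the same constant.**  `w` measurable, positive, normalised, maximal at
`x₀`; `f` bounded measurable `π`-centred.  Then `|C_f(t)| ≤ (1 − 1/w(x₀))^t·∫ f² dπ` for every `t` and
`τ_int(f) ≤ w(x₀) − 1/2`. [ours] -/
theorem indepMH_autocorrelation_of_mode (hw : Measurable w) (hw0 : ∀ y, 0 < w y) {x₀ : Ω}
    (hmax : ∀ y, w y ≤ w x₀) [IsProbabilityMeasure (q.withDensity fun y => ENNReal.ofReal (w y))]
    {f : Ω → ℝ} (hf : Measurable f) {C : ℝ} (hC : ∀ x, |f x| ≤ C)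
    (hf0 : ∫ x, f x ∂(q.withDensity fun y => ENNReal.ofReal (w y)) = 0) :
    (∀ t : ℕ, |Summit.Ventures.LatticeQCDFlow.Scoring.autocov (indepMH q w)
        (q.withDensity fun y => ENNReal.ofReal (w y)) f t| ≤
        (1 - (w x₀)⁻¹) ^ t * ∫ x, f x ^ 2 ∂(q.withDensity fun y => ENNReal.ofReal (w y))) ∧
    Summit.Ventures.LatticeQCDFlow.Scoring.tauInt (fun t =>
        Summit.Ventures.LatticeQCDFlow.Scoring.autocov (indepMH q w)
          (q.withDensity fun y => ENNReal.ofReal (w y)) f t /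
        Summit.Ventures.LatticeQCDFlow.Scoring.autocov (indepMH q w)
          (q.withDensity fun y => ENNReal.ofReal (w y)) f 0) ≤ w x₀ - 1 / 2 := by
  haveI : Fact (Measurable w) := ⟨hw⟩
  have hW : 1 ≤ w x₀ := one_le_of_mode (q := q) hmax
  have hWpos : 0 < w x₀ := zero_lt_one.trans_le hW
  have hmin : ∀ x {B : Set Ω}, MeasurableSet B →
      (ENNReal.ofReal (w x₀))⁻¹ * (q.withDensity fun y => ENNReal.ofReal (w y)) B ≤ indepMH q w x B :=
    fun x B hB => indepMH_apply_ge hw hw0 hmax x hB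
  have hinv := indepMH_invariant (q := q) hw hw0
  have hε0 : 0 < (ENNReal.ofReal (w x₀))⁻¹ := ENNReal.inv_pos.2 ENNReal.ofReal_ne_top
  have htoReal : ((ENNReal.ofReal (w x₀))⁻¹).toReal = (w x₀)⁻¹ := by
    rw [ENNReal.toReal_inv, ENNReal.toReal_ofReal hWpos.le]
  refine ⟨fun t => ?_, ?_⟩
  · have h := Summit.Ventures.LatticeQCDFlow.Scoring.abs_autocov_le_of_doeblin hinv hmin hf hC hf0 t
    rwa [htoReal] at h
  · have h := Summit.Ventures.LatticeQCDFlow.Scoring.tauInt_le_of_doeblin hinv hmin hε0 hf hC hf0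
    rwa [htoReal, one_div, inv_inv] at h

/-- **The expected occupation time of the mode is exactly `w(x₀)`** (normalised weight, `q{x₀} = 0`): the
geometric law sums to `Σ_t (K^t δ_{x₀})({x₀}) = 1/A(x₀) = w(x₀)`. [ours] -/
theorem hasSum_iterate_dirac_mode_singleton (hw : Measurable w) (hw0 : ∀ y, 0 < w y) {x₀ : Ω}
    (hmax : ∀ y, w y ≤ w x₀) (hqx : q {x₀} = 0)
    [IsProbabilityMeasure (q.withDensity fun y => ENNReal.ofReal (w y))] :
    HasSum (fun t : ℕ => ((fun m : Measure Ω => m.bind (indepMH q w))^[t] (Measure.dirac x₀)).real {x₀})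
      (w x₀) := by
  have hW : 1 ≤ w x₀ := one_le_of_mode (q := q) hmax
  have hWpos : 0 < w x₀ := zero_lt_one.trans_le hW
  have hone : ∫⁻ y, ENNReal.ofReal (w y) ∂q = ENNReal.ofReal 1 := by
    have h1 : (q.withDensity fun y => ENNReal.ofReal (w y)) Set.univ = 1 := measure_univ
    rw [withDensity_apply _ MeasurableSet.univ, Measure.restrict_univ] at h1
    rw [h1, ENNReal.ofReal_one]
  have hlaw : ∀ t : ℕ, ((fun m : Measure Ω => m.bind (indepMH q w))^[t] (Measure.dirac x₀)).real {x₀} =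
      (1 - (w x₀)⁻¹) ^ t := fun t => by
    rw [iterate_bind_indepMH_dirac_singleton_real_eq_of_mode (q := q) hw hw0 hqx hmax zero_le_one hone t, one_div]
  simp_rw [hlaw]
  have hr0 : 0 ≤ 1 - (w x₀)⁻¹ := sub_nonneg.2 (inv_le_one_of_one_le₀ hW)
  have hr1 : 1 - (w x₀)⁻¹ < 1 := sub_lt_self _ (inv_pos.2 hWpos)
  have h := hasSum_geometric_of_lt_one hr0 hr1
  rwa [sub_sub_cancel, inv_inv] at h

end Summit.Ventures.LatticeQCDFlow.Exactness
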